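import Literature.Analysis.FluidPDE.TorusStrainProjection
import Literature.Analysis.FunctionSpaces.TorusInverseLaplacianL2
import HarnessLib

/-!
# Miller's strain space `L²_{st}` in Fourier variables on the flat torus: the symbol of `P_{st}`
# and the characterisation `−ΔS + 2∇_{sym}(div S) = 0` (ARMA 235 (2020), Prop 2.3)

Analysis/FluidPDE support file (theorems only, fully proved; no definitions, no named facts).
Search for candidate a priori estimates; no regularity claim.

E. Miller treats the Navier–Stokes equation as an evolution equation for the strain `S = ∇_{sym}u`
on the constraint space `L²_{st} = {½∇⊗u + ½(∇⊗u)ᵀ : u ∈ Ḣ¹, ∇·u = 0}` (ARMA 235 (2020), Def 2.2),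
characterised by a linear PDE (Prop 2.3): `S ∈ L²_{st}` iff `tr S = 0` and

  `−ΔS + 2∇_{sym}(div S) = 0`, i.e. `−ΔS_{ij} + ∑_k ∂_i∂_k S_{kj} + ∂_j∂_k S_{ki} = 0` (2.11),

"satisfied pointwise almost everywhere in Fourier space, that is if
`|ξ|²Ŝ(ξ) − (ξ⊗ξ)Ŝ(ξ) − Ŝ(ξ)(ξ⊗ξ) = 0`" (2.10), the velocity being recovered by
`u = −2 div(−Δ)⁻¹S` (2.7)/(2.15). The perturbative criteria of Pure Appl. Anal. 8 (2026), Thms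
1.8–1.10, are stated with the orthogonal projection `P_{st}` onto `L²_{st}`, about which Miller
remarks (Rem. 1.11): "the conditions … could be studied numerically using candidate blowup
scenarios … the projections in question are only simple to compute in Fourier space; in physical
space they are matrices of Riesz transforms". The tree realises `P_{st}` on smooth matrix fields on
`T^d` as the explicit operator `Torus.strainProjection M = ∇_{sym}z_M`,
`z_M = Torus.strainPotential M = 2Δ⁻¹div_{sym}M − 2∇Δ⁻²(div div sym M)` (file
`TorusStrainProjection`). This file supplies the Fourier side, for every finite index type `d`:

**§1 The symbol of `P_{st}`** (`k ∈ ℤ^d`, `K = |k|²`, `N̂ = ½(𝓕M(k) + 𝓕M(k)ᵀ)`):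
* `Torus.mFourierCoeff_strainDiv`, `Torus.mFourierCoeff_strainDivDiv`,
  `Torus.mFourierCoeff_strainPotential_apply`, `Torus.mFourierCoeff_strainProjection_eq_potential` —
  `𝓕(div_{sym}M) = 2πi N̂k`, `𝓕(div div sym M) = (2πi)² kᵀN̂k`, `𝓕(z_M)`, `𝓕(P_{st}M) = πi(k⊗ẑ + ẑ⊗k)`;
* **`Torus.mFourierCoeff_strainProjection`**: for `k ≠ 0`,
  `𝓕(P_{st}M)(k) = (k⊗ŵ + ŵ⊗k)/K`, `ŵ = N̂k − (kᵀN̂k/K)k = P_{k^⊥}(N̂k)` (componentwise, with the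
  coefficient array `N` passed as an argument; both sides vanish at `k = 0`);
  `Torus.mFourierCoeff_strainProjection_of_symm` (symmetric `M`: `N̂ = 𝓕M(k)`);
* `Torus.mFourierCoeff_strainProjection_zero`, `Torus.integral_strainProjection` (zero mode / mean
  zero), `Torus.sum_strainProjection_diag_eq_zero` (`tr P_{st}M = div z_M = 0`),
  `Torus.hasSum_sq_mFourierCoeff_strainProjection` (Parseval: `‖P_{st}M‖²_{L²}` mode by mode).

**§2 Prop 2.3 on `T^d`** (smooth symmetric matrix fields `S`):
* `Torus.mFourierCoeff_strainConsistency` — `𝓕` of the operator in (2.11) is `4π²` times the matrix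
  in (2.10); `Torus.strainConsistency_iff_fourier` — **(2.11) ⟺ (2.10) for all `k ∈ ℤ^d`**;
* forward half: `Torus.strainConsistency_symGrad` (**`S = ∇_{sym}u`, `∇·u = 0` ⇒ (2.11)**),
  `Torus.sum_symGrad_diag_eq_zero` (`tr S = ∇·u = 0`), `Torus.integral_symGrad_eq_zero` (`∫S = 0`);
* converse half: `Torus.strainProjection_eq_self_of_strainConsistency` (**(2.11) + `tr S = 0` +
  `∫S = 0` ⇒ `P_{st}S = S`**), `Torus.strainPotential_eq_of_strainConsistency` (then
  `z_S = 2Δ⁻¹div S = −2div(−Δ)⁻¹S`, Miller's `u`, and `S = ∇_{sym}z_S`);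
* **`Torus.exists_symGrad_iff_strainConsistency`** — Prop 2.3: `(∃ u smooth, ∇·u = 0, S = ∇_{sym}u)
  ⟺ (tr S = 0 ∧ ∫S = 0 ∧ (2.11))`; `Torus.strainProjection_eq_self_iff_strainConsistency` — the same
  set is the fixed-point set of `P_{st}`.

**§3 Miller–Sawyer, Trans. AMS Ser. B 10 (2023), Thm 3.1 on `T^d`** (appended gen 29, v2):
* **`Torus.integral_sq_symGrad_diag_le_half`** — for smooth divergence-free `u` and every unit vector
  `v ∈ ℝ^d`: `‖vᵀS(u)v‖²_{L²} ≤ ½‖S(u)‖²_{L²}` ("a single diagonal entry of a strain matrix carries at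
  most half of the `L²` mass", printed as `‖S ⊙ (v⊗v)‖² ≤ ½‖S‖²` for `S ∈ L²_{st}(ℝ³)`), by the printed
  Fourier computation mode by mode (`vᵀŜ(k)v = 2πi(v·k)(v·û)`, `|Ŝ(k)|² = 2π²|k|²|û|²`, `k·û = 0`,
  `4s(1 − s) ≤ 1`) and Parseval; sharpness (Thm 3.2) not typed.

Proof architecture. The printed proof is followed, read on Fourier coefficients (Grafakos,
Prop. 3.2.6 (8): `𝓕(∂ⱼf) = 2πikⱼ𝓕f`; tree `Torus.mFourierCoeff_ofReal_invLaplacian`: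
`𝓕(Δ⁻¹f) = −𝓕f/(4π²K)` off the zero mode; uniqueness `Torus.eq_of_forall_mFourierCoeff_eq`):
forward — Miller's `−2 div ∇_{sym}u = −Δu − ∇(∇·u)` becomes `Ŝ = πi(k⊗û + û⊗k)`, `k·û = 0`, which
the matrix of (2.10) annihilates; converse — Miller's `∇_{sym}(−Δ)⁻¹(−2 div S) = (−Δ)⁻¹(−ΔS) = S`
becomes: (2.10) gives `KŜ_{ab} = k_a(Ŝk)_b + k_b(Ŝk)_a`, its diagonal with `tr Ŝ = 0` gives
`kᵀŜk = 0` (so `div div S = 0`, the step "(2.16)" making `u` divergence free), whence the symbol of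
`P_{st}` returns `Ŝ`, and `P_{st}S = S` exhibits `S = ∇_{sym}z_S` with `z_S` divergence free
(tree `Torus.isDivFree_strainPotential`).

Scope (faithfulness). Miller's statement is on `ℝ³` for `S ∈ L²(ℝ³; S^{3×3})`; here: the flat
torus `T^d = UnitAddTorus d` (any finite `d`; nonempty where `Δ⁻¹` enters) and smooth fields — the
setting of the functional-mining census. TORUS DEVIATION, stated in every affected docstring: the
zero mode must be excluded separately (`∫S = 0`, i.e. `Ŝ(0) = 0`); on `ℝ³` the frequency `ξ = 0`
is Lebesgue-null and `u ∈ Ḣ¹` is homogeneous, while on `T^d` constant trace-free symmetric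
matrices solve (2.11) without being periodic strains. The `L²`-closure is not developed.
Beyond-source declarations (proved here; not displayed in the cited texts): the explicit symbol
`(k⊗ŵ + ŵ⊗k)/K` of `P_{st}` (Miller only remarks that `P_{st}` is simple in Fourier space) and the
Parseval bookkeeping — derived API of the tree operator, for the cell's bank/census numerics
(pub-nsfunc CRITERIA §A25, queue item (γ)).

## Mathlib / tree search

Tree (used): `Torus.strainProjection`, `Torus.strainPotential(_apply)`, `Torus.strainDiv`,
`Torus.strainDivDiv`, `Torus.isSmooth_strain*`, `Torus.isDivFree_strainPotential`,
`Torus.strainProjection_symGrad` (`FluidPDE/TorusStrainProjection`); `Torus.mFourierCoeff_partialDeriv`,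
`Torus.mFourierCoeff_eq_integral_volume`, `Torus.partialDeriv_clm_comp`
(`FunctionSpaces/TorusFourierCalculus`); `Torus.mFourierCoeff_ofReal_invLaplacian`,
`Torus.invLaplacianMultiplier`, `Torus.hasSum_sq_mFourierCoeff_ofReal`,
`Torus.mFourierCoeff_zero_eq_integral` (`TorusInverseLaplacianL2`); `Torus.mFourierCoeff_laplacian_complex`,
`Torus.eq_of_forall_mFourierCoeff_eq`, `Torus.mFourierCoeff_const_real`, `Torus.IsSmooth.ofReal`
(`TorusFourierConvolution`); `Torus.mFourierCoeff_finset_sum` (`TorusFourierModes`),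
`Torus.mFourierCoeff_sub`, `Torus.integrable_mFourier_smul'` (`TorusTrigPoly`),
`Torus.mFourierCoeff_const_smul` (`TorusSobolevNorm`), `Torus.laplacian_clm_comp_apply`,
`Torus.invLaplacian_zero` (`TorusInverseLaplacianCalculus`), `Torus.partialDeriv_apply_coord`,
`Torus.divergence_eq_sum_partialDeriv_apply` (`TorusEnstrophyOrthogonality`),
`Torus.integral_partialDeriv_eq_zero_holds` (`TorusCalculusProofs`). Searched (`lean search`):
`mFourierCoeff.*strainProj|strainProj.*mFourierCoeff|L2_st|consistency` — nothing; the Leray–Helmholtz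
symbol files (`TorusLerayHelmholtz*`) treat vector fields only.

## References

* [Miller2019] E. Miller, *A regularity criterion for the Navier–Stokes equation involving only the
  middle eigenvalue of the strain tensor*, Arch. Ration. Mech. Anal. 235 (2020) 99–139 =
  arXiv:1710.05569: §2 display (2.7), Def 2.2, Prop 2.3 with proof (displays (2.10), (2.11),
  (2.15)–(2.16)), Prop 2.4 (held text paper:arxiv-1710.05569, chunks 8–9).
* [Miller2023StrainModel] E. Miller, Anal. PDE 16 (2023) 997–1032 = arXiv:1910.05415: Def 1.2,
  eq. (1.9) (`P_{st}`), Defs 3.3–3.4, Rem. 3.5 (held text, chunk 11).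
* [Miller2026StrainVorticity] E. Miller, Pure Appl. Anal. 8 (2026) 247–270 = arXiv:2407.02691:
  (1.9), Thms 1.8–1.10, Rem. 1.11 (held text, chunk 6).
* [MillerSawyer2023] E. Miller, E. Sawyer, *A Helmholtz-type decomposition for the space of
  symmetric matrices*, Trans. Amer. Math. Soc. Ser. B 10 (2023) 1449–1493 = arXiv:2111.12891:
  Thm 3.1 with proof, Thm 3.2 (held text paper:arxiv-2111.12891, chunk 15).
* [Grafakos2014] L. Grafakos, *Classical Fourier Analysis*, 3rd ed. (2014), Prop. 3.2.6 (8),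
  Prop. 3.2.7 (Parseval), Prop. 3.2.4 (uniqueness).
* [CheskidovLuo2022] A. Cheskidov, X. Luo, Invent. Math. 229 (2022), §7.2 (`Δ⁻¹` on `C^∞(T^d)`).
* [Evans2010] L. C. Evans, *Partial Differential Equations*, 2nd ed., App. C.2 Thm. 1.
-/

noncomputable section

open MeasureTheory Set Function Finset UnitAddTorus
open scoped ContDiff

namespace Literature.Analysis.FluidPDE

open Literature.Analysis.FunctionSpaces

variable {d : Type*} [Fintype d] [DecidableEq d]

namespace StrainSubspaceFourier

variable {M : d → d → UnitAddTorus d → ℝ}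

/-! ### §0 Smoothness and Fourier bookkeeping for real smooth functions -/

omit [DecidableEq d] in
/-- Finite sums of smooth scalar functions are smooth. [folklore] -/
private theorem isSmooth_sum {ι : Type*} (s : Finset ι) {g : ι → UnitAddTorus d → ℝ}
    (hg : ∀ i ∈ s, Torus.IsSmooth (g i)) : Torus.IsSmooth (fun x => ∑ i ∈ s, g i x) := by
  have hl : Torus.lift (fun x => ∑ i ∈ s, g i x) = fun z => ∑ i ∈ s, Torus.lift (g i) z := rfl
  unfold Torus.IsSmooth
  rw [hl]
  exact ContDiff.sum fun i hi => hg i hi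

omit [DecidableEq d] in
/-- The symmetrised entries `½(M_{cb} + M_{bc})` are smooth. [folklore] -/
private theorem isSmooth_symm (hM : ∀ a b, Torus.IsSmooth (M a b)) (c b : d) :
    Torus.IsSmooth (fun z => (M c b z + M b c z) / 2) :=
  ((hM c b).add (hM b c)).div_const 2

omit [DecidableEq d] in
/-- Constant multiples of smooth scalar functions are smooth. [folklore] -/
private theorem smooth_const_mul (c : ℝ) {a : UnitAddTorus d → ℝ} (ha : Torus.IsSmooth a) :
    Torus.IsSmooth (fun y => c * a y) := (Torus.isSmooth_const c).mul ha

omit [DecidableEq d] in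
/-- Continuous real functions complexify to integrable ones. [folklore] -/
private theorem integrable_ofReal {f : UnitAddTorus d → ℝ} (hf : Continuous f) :
    Integrable (fun x => (f x : ℂ)) volume :=
  (Complex.continuous_ofReal.comp hf : Continuous fun x => (f x : ℂ)).integrable_unitAddTorus

omit [DecidableEq d] in
/-- `𝓕(f + g) = 𝓕f + 𝓕g` for continuous real `f, g` (complexified). [folklore] -/
private theorem fc_add {f g : UnitAddTorus d → ℝ} (hf : Continuous f) (hg : Continuous g)
    (k : d → ℤ) :
    mFourierCoeff (fun x => (((f x + g x : ℝ)) : ℂ)) k =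
      mFourierCoeff (fun x => (f x : ℂ)) k + mFourierCoeff (fun x => (g x : ℂ)) k := by
  simp only [Torus.mFourierCoeff_eq_integral_volume, Complex.ofReal_add, smul_add]
  exact integral_add (Torus.integrable_mFourier_smul' (integrable_ofReal hf) k)
    (Torus.integrable_mFourier_smul' (integrable_ofReal hg) k)

omit [DecidableEq d] in
/-- `𝓕(f − g) = 𝓕f − 𝓕g` for continuous real `f, g` (complexified). [folklore] -/
private theorem fc_sub {f g : UnitAddTorus d → ℝ} (hf : Continuous f) (hg : Continuous g)
    (k : d → ℤ) :
    mFourierCoeff (fun x => (((f x - g x : ℝ)) : ℂ)) k =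
      mFourierCoeff (fun x => (f x : ℂ)) k - mFourierCoeff (fun x => (g x : ℂ)) k := by
  simp only [Torus.mFourierCoeff_eq_integral_volume, Complex.ofReal_sub, smul_sub]
  exact integral_sub (Torus.integrable_mFourier_smul' (integrable_ofReal hf) k)
    (Torus.integrable_mFourier_smul' (integrable_ofReal hg) k)

omit [DecidableEq d] in
/-- `𝓕(c f) = c 𝓕f` for real `c` (complexified). [folklore] -/
private theorem fc_const_mul (c : ℝ) (f : UnitAddTorus d → ℝ) (k : d → ℤ) :
    mFourierCoeff (fun x => (((c * f x : ℝ)) : ℂ)) k = (c : ℂ) * mFourierCoeff (fun x => (f x : ℂ)) k := by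
  have h : (fun x => (((c * f x : ℝ)) : ℂ)) = (c : ℂ) • fun x => (f x : ℂ) := by
    funext x; simp only [Pi.smul_apply, smul_eq_mul, Complex.ofReal_mul]
  rw [h, Torus.mFourierCoeff_const_smul, smul_eq_mul]

omit [DecidableEq d] in
/-- `𝓕(f/2) = 𝓕f/2` (complexified). [folklore] -/
private theorem fc_div_two (f : UnitAddTorus d → ℝ) (k : d → ℤ) :
    mFourierCoeff (fun x => (((f x / 2 : ℝ)) : ℂ)) k = mFourierCoeff (fun x => (f x : ℂ)) k / 2 := by
  have h : (fun x => (((f x / 2 : ℝ)) : ℂ)) = ((2 : ℂ)⁻¹) • fun x => (f x : ℂ) := by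
    funext x
    simp only [Pi.smul_apply, smul_eq_mul, Complex.ofReal_div, Complex.ofReal_ofNat]
    ring
  rw [h, Torus.mFourierCoeff_const_smul, smul_eq_mul]
  ring

omit [DecidableEq d] in
/-- `𝓕(∑ᵢ fᵢ) = ∑ᵢ 𝓕fᵢ` for continuous real `fᵢ` (complexified). [folklore] -/
private theorem fc_sum {ι : Type*} (s : Finset ι) {f : ι → UnitAddTorus d → ℝ}
    (hf : ∀ i ∈ s, Continuous (f i)) (k : d → ℤ) :
    mFourierCoeff (fun x => (((∑ i ∈ s, f i x : ℝ)) : ℂ)) k =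
      ∑ i ∈ s, mFourierCoeff (fun x => (f i x : ℂ)) k := by
  have h : (fun x => (((∑ i ∈ s, f i x : ℝ)) : ℂ)) = fun x => ∑ i ∈ s, (fun i x => (f i x : ℂ)) i x := by
    funext x; push_cast; rfl
  rw [h, Torus.mFourierCoeff_finset_sum s (fun i hi => integrable_ofReal (hf i hi))]

/-- `𝓕(∂ⱼf)(k) = 2πi kⱼ 𝓕f(k)` for smooth real `f` (complexified; Grafakos Prop. 3.2.6 (8), tree
`Torus.mFourierCoeff_partialDeriv`). [folklore] -/
private theorem fc_partialDeriv {f : UnitAddTorus d → ℝ} (hf : Torus.IsSmooth f) (j : d) (k : d → ℤ) :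
    mFourierCoeff (fun x => (((Torus.partialDeriv j f x : ℝ)) : ℂ)) k =
      (2 * Real.pi * Complex.I * (k j)) * mFourierCoeff (fun x => (f x : ℂ)) k := by
  have hc : (fun x => (((Torus.partialDeriv j f x : ℝ)) : ℂ)) =
      Torus.partialDeriv j (fun x => (((f x : ℝ)) : ℂ)) := by
    funext x; exact (Torus.partialDeriv_clm_comp hf Complex.ofRealCLM j x).symm
  rw [hc, Torus.mFourierCoeff_partialDeriv hf.ofReal, smul_eq_mul]

/-- `𝓕(Δf)(k) = −4π²|k|² 𝓕f(k)` for smooth real `f` (complexified; tree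
`Torus.mFourierCoeff_laplacian_complex`). [folklore] -/
private theorem fc_laplacian {f : UnitAddTorus d → ℝ} (hf : Torus.IsSmooth f) (k : d → ℤ) :
    mFourierCoeff (fun x => (((Torus.laplacian f x : ℝ)) : ℂ)) k =
      -((4 * Real.pi ^ 2 * Torus.freqNormSq k : ℝ) : ℂ) * mFourierCoeff (fun x => (f x : ℂ)) k := by
  have hc : (fun x => (((Torus.laplacian f x : ℝ)) : ℂ)) =
      Torus.laplacian (fun x => (((f x : ℝ)) : ℂ)) := by
    funext x; exact (Torus.laplacian_clm_comp_apply hf Complex.ofRealCLM x).symm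
  rw [hc, Torus.mFourierCoeff_laplacian_complex hf.ofReal]

/-- `𝓕(Δ⁻¹f)(k) = m(k) 𝓕f(k)` for smooth real `f` (tree `Torus.mFourierCoeff_ofReal_invLaplacian`).
[folklore] -/
private theorem fc_invLaplacian [Nonempty d] {f : UnitAddTorus d → ℝ} (hf : Torus.IsSmooth f)
    (k : d → ℤ) :
    mFourierCoeff (fun x => (((Torus.invLaplacian f x : ℝ)) : ℂ)) k =
      Torus.invLaplacianMultiplier k * mFourierCoeff (fun x => (f x : ℂ)) k :=
  Torus.mFourierCoeff_ofReal_invLaplacian hf k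

omit [DecidableEq d] in
/-- The zeroth Fourier coefficient of a real function is its mean. [folklore] -/
private theorem fc_zero (f : UnitAddTorus d → ℝ) :
    mFourierCoeff (fun x => (f x : ℂ)) 0 = ((∫ x, f x : ℝ) : ℂ) := by
  rw [Torus.mFourierCoeff_zero_eq_integral]
  exact integral_complex_ofReal

/-! ### §1 Fourier coefficients of `div_{sym}M`, `div div sym M`, the potential `z_M`, and `P_{st}M` -/

/-- **Fourier coefficients of the symmetrised divergence**:
`𝓕((div_{sym}M)_b)(k) = ∑_c 2πi k_c N̂_{cb}(k)`, `N̂ = ½(𝓕M + 𝓕Mᵀ)` the coefficients of `sym M`.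
[cite: Miller2019, §2 display (2.7) (`u = −2 div(−Δ)⁻¹S`); Grafakos2014, Prop. 3.2.6 (8)] -/
theorem _root_.Literature.Analysis.FluidPDE.Torus.mFourierCoeff_strainDiv
    (hM : ∀ a b, Torus.IsSmooth (M a b)) (b : d) (k : d → ℤ) :
    mFourierCoeff (fun x => (((Torus.strainDiv M b x : ℝ)) : ℂ)) k =
      ∑ c, (2 * Real.pi * Complex.I * (k c)) *
        ((mFourierCoeff (fun x => (M c b x : ℂ)) k + mFourierCoeff (fun x => (M b c x : ℂ)) k) / 2) := by
  unfold Torus.strainDiv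
  rw [fc_sum _ fun c _ => ((isSmooth_symm hM c b).partialDeriv c).continuous]
  refine Finset.sum_congr rfl fun c _ => ?_
  rw [fc_partialDeriv (isSmooth_symm hM c b), fc_div_two, fc_add (hM c b).continuous (hM b c).continuous]

/-- **Fourier coefficients of the double divergence**:
`𝓕(div div sym M)(k) = ∑_b 2πi k_b ∑_c 2πi k_c N̂_{cb}(k) = −4π² kᵀN̂(k)k`.
[cite: Miller2019, Prop 2.4 (proof: `∑ᵢⱼ ξᵢξⱼŜᵢⱼ(ξ)`); Grafakos2014, Prop. 3.2.6 (8)] -/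
theorem _root_.Literature.Analysis.FluidPDE.Torus.mFourierCoeff_strainDivDiv
    (hM : ∀ a b, Torus.IsSmooth (M a b)) (k : d → ℤ) :
    mFourierCoeff (fun x => (((Torus.strainDivDiv M x : ℝ)) : ℂ)) k =
      ∑ b, (2 * Real.pi * Complex.I * (k b)) * ∑ c, (2 * Real.pi * Complex.I * (k c)) *
        ((mFourierCoeff (fun x => (M c b x : ℂ)) k + mFourierCoeff (fun x => (M b c x : ℂ)) k) / 2) := by
  unfold Torus.strainDivDiv
  rw [fc_sum _ fun b _ => ((Torus.isSmooth_strainDiv hM b).partialDeriv b).continuous]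
  refine Finset.sum_congr rfl fun b _ => ?_
  rw [fc_partialDeriv (Torus.isSmooth_strainDiv hM b), Torus.mFourierCoeff_strainDiv hM b k]

/-- **Fourier coefficients of the potential** `z_M = 2Δ⁻¹div_{sym}M − 2∇Δ⁻²(div div sym M)`:
`𝓕((z_M)_b)(k) = 2m(k)𝓕((div_{sym}M)_b)(k) − 2(2πi k_b)m(k)²𝓕(div div sym M)(k)`,
`m(k) = (−4π²|k|²)⁻¹` (`0` at `k = 0`) the symbol of `Δ⁻¹`.
[cite: Miller2019, §2 display (2.7); CheskidovLuo2022, §7.2] -/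
theorem _root_.Literature.Analysis.FluidPDE.Torus.mFourierCoeff_strainPotential_apply [Nonempty d]
    (hM : ∀ a b, Torus.IsSmooth (M a b)) (b : d) (k : d → ℤ) :
    mFourierCoeff (fun x => (((Torus.strainPotential M x b : ℝ)) : ℂ)) k =
      2 * Torus.invLaplacianMultiplier k *
          mFourierCoeff (fun x => (((Torus.strainDiv M b x : ℝ)) : ℂ)) k -
        2 * (2 * Real.pi * Complex.I * (k b)) * Torus.invLaplacianMultiplier k ^ 2 *
          mFourierCoeff (fun x => (((Torus.strainDivDiv M x : ℝ)) : ℂ)) k := by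
  have h1 : Torus.IsSmooth (Torus.invLaplacian (Torus.strainDiv M b)) :=
    Torus.isSmooth_invLaplacian (Torus.isSmooth_strainDiv hM b)
  have hg : Torus.IsSmooth (Torus.strainDivDiv M) := Torus.isSmooth_strainDivDiv hM
  have hIg : Torus.IsSmooth (Torus.invLaplacian (Torus.strainDivDiv M)) := Torus.isSmooth_invLaplacian hg
  have hIIg : Torus.IsSmooth (Torus.invLaplacian (Torus.invLaplacian (Torus.strainDivDiv M))) :=
    Torus.isSmooth_invLaplacian hIg
  simp_rw [Torus.strainPotential_apply]
  rw [fc_sub (smooth_const_mul 2 h1).continuous (smooth_const_mul 2 (hIIg.partialDeriv b)).continuous,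
    fc_const_mul, fc_const_mul, fc_invLaplacian (Torus.isSmooth_strainDiv hM b), fc_partialDeriv hIIg,
    fc_invLaplacian hIg, fc_invLaplacian hg]
  push_cast
  ring

/-- `P_{st}M` in terms of the potential, on Fourier coefficients:
`𝓕((P_{st}M)_{ab})(k) = ½(2πi k_a 𝓕((z_M)_b)(k) + 2πi k_b 𝓕((z_M)_a)(k))`.
[cite: Miller2023StrainModel, Def 1.2 and eq. (1.9); Grafakos2014, Prop. 3.2.6 (8)] -/
theorem _root_.Literature.Analysis.FluidPDE.Torus.mFourierCoeff_strainProjection_eq_potential [Nonempty d]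
    (hM : ∀ a b, Torus.IsSmooth (M a b)) (a b : d) (k : d → ℤ) :
    mFourierCoeff (fun x => (((Torus.strainProjection M a b x : ℝ)) : ℂ)) k =
      ((2 * Real.pi * Complex.I * (k a)) *
          mFourierCoeff (fun x => (((Torus.strainPotential M x b : ℝ)) : ℂ)) k +
        (2 * Real.pi * Complex.I * (k b)) *
          mFourierCoeff (fun x => (((Torus.strainPotential M x a : ℝ)) : ℂ)) k) / 2 := by
  have hZ := Torus.isSmooth_strainPotential hM
  have hZ1 : Torus.IsContDiff 1 (Torus.strainPotential M) := hZ.isContDiff (by simp)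
  have hscal : (fun x => (((Torus.strainProjection M a b x : ℝ)) : ℂ)) = fun x =>
      ((((Torus.partialDeriv a (fun y => Torus.strainPotential M y b) x +
        Torus.partialDeriv b (fun y => Torus.strainPotential M y a) x) / 2 : ℝ)) : ℂ) := by
    funext x
    rw [Torus.strainProjection, Torus.partialDeriv_apply_coord hZ1, Torus.partialDeriv_apply_coord hZ1]
  rw [hscal, fc_div_two,
    fc_add ((Torus.isSmooth_strainPotential_apply hM b).partialDeriv a).continuous
      ((Torus.isSmooth_strainPotential_apply hM a).partialDeriv b).continuous,
    fc_partialDeriv (Torus.isSmooth_strainPotential_apply hM b),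
    fc_partialDeriv (Torus.isSmooth_strainPotential_apply hM a)]

/-- `𝓕((div_{sym}M)_b)(k) = 2πi ∑_c N̂_{bc}k_c` with the symmetrised coefficient matrix `N̂` passed as
an argument. [folklore] -/
private theorem fc_strainDiv_N (hM : ∀ a b, Torus.IsSmooth (M a b)) (k : d → ℤ) (N : d → d → ℂ)
    (hN : ∀ e c, N e c =
      (mFourierCoeff (fun x => (M e c x : ℂ)) k + mFourierCoeff (fun x => (M c e x : ℂ)) k) / 2)
    (b : d) :
    mFourierCoeff (fun x => (((Torus.strainDiv M b x : ℝ)) : ℂ)) k =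
      2 * Real.pi * Complex.I * ∑ c, N b c * (k c) := by
  have hNsymm : ∀ e c, N c e = N e c := fun e c => by rw [hN, hN e c, add_comm]
  rw [Torus.mFourierCoeff_strainDiv hM b k, Finset.mul_sum]
  refine Finset.sum_congr rfl fun c _ => ?_
  rw [← hN c b, hNsymm]
  ring

/-- `𝓕(div div sym M)(k) = (2πi)² ∑_{e,c} k_e N̂_{ec} k_c`. [folklore] -/
private theorem fc_strainDivDiv_N (hM : ∀ a b, Torus.IsSmooth (M a b)) (k : d → ℤ) (N : d → d → ℂ)
    (hN : ∀ e c, N e c =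
      (mFourierCoeff (fun x => (M e c x : ℂ)) k + mFourierCoeff (fun x => (M c e x : ℂ)) k) / 2) :
    mFourierCoeff (fun x => (((Torus.strainDivDiv M x : ℝ)) : ℂ)) k =
      (2 * Real.pi * Complex.I) ^ 2 * ∑ e, ∑ c, (k e : ℂ) * N e c * (k c) := by
  have hNsymm : ∀ e c, N c e = N e c := fun e c => by rw [hN, hN e c, add_comm]
  rw [Torus.mFourierCoeff_strainDivDiv hM k, Finset.mul_sum]
  refine Finset.sum_congr rfl fun e _ => ?_
  rw [Finset.mul_sum, Finset.mul_sum]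
  refine Finset.sum_congr rfl fun c _ => ?_
  rw [← hN c e, hNsymm]
  ring

/-- **The Fourier symbol of Miller's strain projection `P_{st}`** (the `L²`-orthogonal projection
onto the strain space `L²_{st}`; "the projections in question are only simple to compute in
Fourier space; in physical space they are matrices of Riesz transforms", Miller, Pure Appl. Anal. 8
(2026), Rem. 1.11). For a smooth matrix field `M` on `T^d` and a frequency `k ≠ 0`, with
`N̂ = ½(𝓕M(k) + 𝓕M(k)ᵀ)` the coefficient matrix of `sym M` and `K = |k|²`,

  `𝓕(P_{st}M)(k) = (k ⊗ ŵ + ŵ ⊗ k)/K`,  `ŵ = N̂k − (kᵀN̂k/K) k = P_{k^⊥}(N̂k)`,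

i.e. `𝓕((P_{st}M)_{ab})(k) = (k_a ŵ_b + k_b ŵ_a)/K` with `ŵ_b = ∑_c N̂_{bc}k_c − (∑_{e,c} k_e N̂_{ec} k_c /K) k_b`;
at `k = 0` both sides vanish (Lean: `x/0 = 0`). This is the tree operator
`Torus.strainProjection M = ∇_{sym} z_M`, `z_M = 2Δ⁻¹div_{sym}M − 2∇Δ⁻²(div div sym M)` (Miller's
`u = −2 div(−Δ)⁻¹S`, Leray-projected) read on Fourier coefficients: `𝓕(∂ⱼf) = 2πi kⱼ𝓕f`,
`𝓕(Δ⁻¹f) = −𝓕f/(4π²K)`. The coefficient matrix `N̂` is passed as an argument `N` with its defining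
equations `hN`, so that users may supply their own (FFT) array.
[cite: Miller2019, §2 display (2.7) and Prop 2.3; Miller2026StrainVorticity, Rem. 1.11; Grafakos2014, Prop. 3.2.6 (8)] -/
theorem _root_.Literature.Analysis.FluidPDE.Torus.mFourierCoeff_strainProjection [Nonempty d]
    (hM : ∀ a b, Torus.IsSmooth (M a b)) (k : d → ℤ) (N : d → d → ℂ)
    (hN : ∀ e c, N e c =
      (mFourierCoeff (fun x => (M e c x : ℂ)) k + mFourierCoeff (fun x => (M c e x : ℂ)) k) / 2)
    (a b : d) :
    mFourierCoeff (fun x => (((Torus.strainProjection M a b x : ℝ)) : ℂ)) k =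
      ((k a : ℂ) * (∑ c, N b c * (k c) -
          (∑ e, ∑ c, (k e : ℂ) * N e c * (k c)) / (Torus.freqNormSq k : ℂ) * (k b)) +
        (k b : ℂ) * (∑ c, N a c * (k c) -
          (∑ e, ∑ c, (k e : ℂ) * N e c * (k c)) / (Torus.freqNormSq k : ℂ) * (k a))) /
        (Torus.freqNormSq k : ℂ) := by
  rw [Torus.mFourierCoeff_strainProjection_eq_potential hM,
    Torus.mFourierCoeff_strainPotential_apply hM, Torus.mFourierCoeff_strainPotential_apply hM,
    fc_strainDiv_N hM k N hN, fc_strainDiv_N hM k N hN, fc_strainDivDiv_N hM k N hN]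
  set Ta : ℂ := ∑ c, N a c * (k c) with hTa
  set Tb : ℂ := ∑ c, N b c * (k c) with hTb
  set Q : ℂ := ∑ e, ∑ c, (k e : ℂ) * N e c * (k c) with hQ
  have hI2 : Complex.I ^ 2 = -1 := Complex.I_sq
  have hI4 : Complex.I ^ 4 = 1 := by
    rw [show (4 : ℕ) = 2 * 2 from rfl, pow_mul, hI2]; norm_num
  by_cases hk : k = 0
  · subst hk
    simp
  · have hK : (Torus.freqNormSq k : ℂ) ≠ 0 := by
      have := Torus.one_le_freqNormSq_of_ne_zero hk
      exact_mod_cast (by linarith : Torus.freqNormSq k ≠ 0)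
    have hπ : (Real.pi : ℂ) ≠ 0 := by exact_mod_cast Real.pi_ne_zero
    have hm : Torus.invLaplacianMultiplier k =
        -((4 * Real.pi ^ 2 * Torus.freqNormSq k : ℝ) : ℂ)⁻¹ := by
      rw [Torus.invLaplacianMultiplier, if_neg hk, Complex.ofReal_neg, inv_neg]
    rw [hm]
    push_cast
    field_simp
    ring_nf
    simp only [hI2, hI4]
    ring

/-- **The symbol of `P_{st}` on symmetric fields**: for a smooth SYMMETRIC matrix field `M`
(`M_{ab} = M_{ba}`) the symmetrisation is vacuous, `N̂ = 𝓕M(k)`, and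
`𝓕((P_{st}M)_{ab})(k) = (k_a ŵ_b + k_b ŵ_a)/K`, `ŵ_b = ∑_c 𝓕M_{bc} k_c − (kᵀ𝓕M k/K) k_b`.
[cite: Miller2019, §2 display (2.7) and Prop 2.3; Miller2026StrainVorticity, Rem. 1.11; Grafakos2014, Prop. 3.2.6 (8)] -/
theorem _root_.Literature.Analysis.FluidPDE.Torus.mFourierCoeff_strainProjection_of_symm [Nonempty d]
    (hM : ∀ a b, Torus.IsSmooth (M a b)) (hsymm : ∀ a b x, M a b x = M b a x) (k : d → ℤ)
    (N : d → d → ℂ) (hN : ∀ e c, N e c = mFourierCoeff (fun x => (M e c x : ℂ)) k) (a b : d) :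
    mFourierCoeff (fun x => (((Torus.strainProjection M a b x : ℝ)) : ℂ)) k =
      ((k a : ℂ) * (∑ c, N b c * (k c) -
          (∑ e, ∑ c, (k e : ℂ) * N e c * (k c)) / (Torus.freqNormSq k : ℂ) * (k b)) +
        (k b : ℂ) * (∑ c, N a c * (k c) -
          (∑ e, ∑ c, (k e : ℂ) * N e c * (k c)) / (Torus.freqNormSq k : ℂ) * (k a))) /
        (Torus.freqNormSq k : ℂ) := by
  refine Torus.mFourierCoeff_strainProjection hM k N (fun e c => ?_) a b
  have hfun : (fun x => (M c e x : ℂ)) = fun x => (M e c x : ℂ) := funext fun x => by rw [hsymm c e x]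
  rw [hN, hfun]
  ring

/-- **The zero mode of `P_{st}M` vanishes**: `𝓕(P_{st}M)(0) = ∫ P_{st}M = 0` (the entries of
`P_{st}M = ∇_{sym}z_M` are derivatives of periodic functions) — the `k = 0` companion of the symbol,
matching Miller's homogeneous setting `u ∈ Ḣ¹`. [cite: Miller2019, Def 2.2; Grafakos2014, Prop. 3.2.6 (8)] -/
theorem _root_.Literature.Analysis.FluidPDE.Torus.mFourierCoeff_strainProjection_zero [Nonempty d]
    (hM : ∀ a b, Torus.IsSmooth (M a b)) (a b : d) :
    mFourierCoeff (fun x => (((Torus.strainProjection M a b x : ℝ)) : ℂ)) 0 = 0 := by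
  rw [Torus.mFourierCoeff_strainProjection_eq_potential hM]
  simp

/-- **`∫ (P_{st}M)_{ab} = 0`** (mean zero entries). [cite: Miller2019, Def 2.2] -/
theorem _root_.Literature.Analysis.FluidPDE.Torus.integral_strainProjection [Nonempty d]
    (hM : ∀ a b, Torus.IsSmooth (M a b)) (a b : d) :
    ∫ x, Torus.strainProjection M a b x = 0 := by
  have h := Torus.mFourierCoeff_strainProjection_zero hM a b
  rw [fc_zero] at h
  exact_mod_cast h

/-- **`P_{st}M` is trace free**: `∑_a (P_{st}M)_{aa} = div z_M = 0` (Miller, ARMA 235 (2020),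
Prop 2.3: `tr S = ∇·u = 0` on `L²_{st}`). [cite: Miller2019, Prop 2.3] -/
theorem _root_.Literature.Analysis.FluidPDE.Torus.sum_strainProjection_diag_eq_zero [Nonempty d]
    (hM : ∀ a b, Torus.IsSmooth (M a b)) (x : UnitAddTorus d) :
    ∑ a, Torus.strainProjection M a a x = 0 := by
  have hZ1 : Torus.IsContDiff 1 (Torus.strainPotential M) :=
    (Torus.isSmooth_strainPotential hM).isContDiff (by simp)
  have hdiv := Torus.isDivFree_strainPotential hM x
  rw [Torus.divergence_eq_sum_partialDeriv_apply hZ1] at hdiv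
  rw [← hdiv]
  refine Finset.sum_congr rfl fun a _ => ?_
  rw [Torus.strainProjection]
  ring

omit [DecidableEq d] in
/-- Parseval for a finite family of continuous real functions. [folklore] -/
private theorem hasSum_sum_sq {ι : Type*} (s : Finset ι) {f : ι → UnitAddTorus d → ℝ}
    (hf : ∀ i ∈ s, Continuous (f i)) :
    HasSum (fun k => ∑ i ∈ s, ‖mFourierCoeff (fun x => (f i x : ℂ)) k‖ ^ 2)
      (∑ i ∈ s, ∫ x, f i x ^ 2) :=
  hasSum_sum fun i hi => Torus.hasSum_sq_mFourierCoeff_ofReal (hf i hi)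

/-- **Parseval for `P_{st}M`**: `‖P_{st}M‖²_{L²} = ∑_{ab} ∫ (P_{st}M)²_{ab} = ∑_k ∑_{ab} |𝓕((P_{st}M)_{ab})(k)|²`
— with `Torus.mFourierCoeff_strainProjection` this evaluates Miller's `‖P_{st}(·)‖_{L²}` mode by
mode. [cite: Grafakos2014, Prop. 3.2.7 (3); Miller2026StrainVorticity, Rem. 1.11] -/
theorem _root_.Literature.Analysis.FluidPDE.Torus.hasSum_sq_mFourierCoeff_strainProjection [Nonempty d]
    (hM : ∀ a b, Torus.IsSmooth (M a b)) :
    HasSum (fun k => ∑ a, ∑ b,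
        ‖mFourierCoeff (fun x => (((Torus.strainProjection M a b x : ℝ)) : ℂ)) k‖ ^ 2)
      (∑ a, ∑ b, ∫ x, Torus.strainProjection M a b x ^ 2) :=
  hasSum_sum fun a _ => hasSum_sum_sq _ fun b _ => (Torus.isSmooth_strainProjection hM a b).continuous

/-! ### §2 Miller's characterisation of the strain space (ARMA 235 (2020), Prop 2.3) on `T^d` -/

section Consistency

variable {S : d → d → UnitAddTorus d → ℝ}

omit [DecidableEq d] in
/-- `𝓕(−f) = −𝓕f` (complexified). [folklore] -/
private theorem fc_neg (f : UnitAddTorus d → ℝ) (k : d → ℤ) :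
    mFourierCoeff (fun x => (((-f x : ℝ)) : ℂ)) k = -mFourierCoeff (fun x => (f x : ℂ)) k := by
  simp only [Torus.mFourierCoeff_eq_integral_volume, Complex.ofReal_neg, smul_neg, integral_neg]

omit [DecidableEq d] in
/-- The Fourier coefficients of the zero function vanish. [folklore] -/
private theorem fc_of_eq_zero {f : UnitAddTorus d → ℝ} (hf : ∀ x, f x = 0) (k : d → ℤ) :
    mFourierCoeff (fun x => (f x : ℂ)) k = 0 := by
  have h : (fun x => (f x : ℂ)) = fun _ => ((0 : ℝ) : ℂ) := funext fun x => by rw [hf x]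
  rw [h, Torus.mFourierCoeff_const_real]
  simp

omit [DecidableEq d] in
/-- A continuous real function with vanishing Fourier coefficients vanishes. [folklore] -/
private theorem eq_zero_of_fc {f : UnitAddTorus d → ℝ} (hf : Continuous f)
    (h : ∀ k, mFourierCoeff (fun x => (f x : ℂ)) k = 0) (x : UnitAddTorus d) : f x = 0 := by
  have hfun : (fun x => (f x : ℂ)) = fun _ => ((0 : ℝ) : ℂ) :=
    Torus.eq_of_forall_mFourierCoeff_eq (Complex.continuous_ofReal.comp hf) continuous_const
      fun k => by rw [h k, Torus.mFourierCoeff_const_real]; simp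
  exact_mod_cast congr_fun hfun x

/-- **The consistency operator on Fourier coefficients**: for a smooth matrix field `S` on `T^d`,

  `𝓕(−ΔS_{ab} + ∑_c (∂_a∂_c S_{cb} + ∂_b∂_c S_{ca}))(k)
     = 4π² (|k|² Ŝ_{ab}(k) − ∑_c k_a k_c Ŝ_{cb}(k) − ∑_c k_b k_c Ŝ_{ca}(k))`

— Miller's passage from the matrix PDE (2.11) `−ΔS_{ij} + ∑_k ∂_i∂_k S_{kj} + ∂_j∂_k S_{ki} = 0` to
its Fourier form (2.10) `|ξ|²Ŝ − (ξ⊗ξ)Ŝ − Ŝ(ξ⊗ξ) = 0`. [cite: Miller2019, Prop 2.3, displays (2.10)–(2.11); Grafakos2014, Prop. 3.2.6 (8)] -/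
theorem _root_.Literature.Analysis.FluidPDE.Torus.mFourierCoeff_strainConsistency
    (hS : ∀ a b, Torus.IsSmooth (S a b)) (a b : d) (k : d → ℤ) :
    mFourierCoeff (fun x => (((-Torus.laplacian (S a b) x +
        ∑ c, (Torus.partialDeriv a (Torus.partialDeriv c (S c b)) x +
          Torus.partialDeriv b (Torus.partialDeriv c (S c a)) x) : ℝ)) : ℂ)) k =
      ((4 * Real.pi ^ 2 : ℝ) : ℂ) *
        ((Torus.freqNormSq k : ℂ) * mFourierCoeff (fun x => (S a b x : ℂ)) k -
          ∑ c, ((k a : ℂ) * (k c) * mFourierCoeff (fun x => (S c b x : ℂ)) k +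
            (k b : ℂ) * (k c) * mFourierCoeff (fun x => (S c a x : ℂ)) k)) := by
  have h2 : ∀ e c f, Torus.IsSmooth (Torus.partialDeriv e (Torus.partialDeriv c (S c f))) :=
    fun e c f => ((hS c f).partialDeriv c).partialDeriv e
  have hpair : ∀ c, Torus.IsSmooth fun x => Torus.partialDeriv a (Torus.partialDeriv c (S c b)) x +
      Torus.partialDeriv b (Torus.partialDeriv c (S c a)) x := fun c => (h2 a c b).add (h2 b c a)
  have hneg : Continuous fun x => -Torus.laplacian (S a b) x := (hS a b).laplacian.continuous.neg
  have hsum : Continuous fun x => ∑ c, (Torus.partialDeriv a (Torus.partialDeriv c (S c b)) x +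
      Torus.partialDeriv b (Torus.partialDeriv c (S c a)) x) :=
    (isSmooth_sum Finset.univ fun c _ => hpair c).continuous
  rw [fc_add hneg hsum, fc_neg, fc_laplacian (hS a b), fc_sum _ fun c _ => (hpair c).continuous]
  simp_rw [fc_add (h2 a _ b).continuous (h2 b _ a).continuous,
    fc_partialDeriv ((hS _ b).partialDeriv _), fc_partialDeriv ((hS _ a).partialDeriv _),
    fc_partialDeriv (hS _ b), fc_partialDeriv (hS _ a)]
  have hI2 : Complex.I ^ 2 = -1 := Complex.I_sq
  rw [mul_sub, Finset.mul_sum, sub_eq_add_neg, ← Finset.sum_neg_distrib]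
  congr 1
  · push_cast; ring
  · refine Finset.sum_congr rfl fun c _ => ?_
    push_cast
    ring_nf
    rw [hI2]
    ring

/-- **Miller, ARMA 235 (2020), Prop 2.3 — the consistency condition in physical and in Fourier
variables are equivalent** on `T^d`: for a smooth symmetric matrix field `S`,

  `−ΔS + 2∇_{sym}(div S) = 0` (components (2.11): `−ΔS_{ab} + ∑_c ∂_a∂_c S_{cb} + ∂_b∂_c S_{ca} = 0`)
  `⟺ ∀ k ∈ ℤ^d: |k|² Ŝ(k) − (k⊗k)Ŝ(k) − Ŝ(k)(k⊗k) = 0` ((2.10), "satisfied pointwise … in Fourier space").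

[cite: Miller2019, Prop 2.3, displays (2.10)–(2.11)] -/
theorem _root_.Literature.Analysis.FluidPDE.Torus.strainConsistency_iff_fourier
    (hS : ∀ a b, Torus.IsSmooth (S a b)) (hsymm : ∀ a b x, S a b x = S b a x) :
    (∀ a b x, -Torus.laplacian (S a b) x +
        ∑ c, (Torus.partialDeriv a (Torus.partialDeriv c (S c b)) x +
          Torus.partialDeriv b (Torus.partialDeriv c (S c a)) x) = 0) ↔
      ∀ (k : d → ℤ) a b, (Torus.freqNormSq k : ℂ) * mFourierCoeff (fun x => (S a b x : ℂ)) k -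
          ∑ c, (k a : ℂ) * (k c) * mFourierCoeff (fun x => (S c b x : ℂ)) k -
          ∑ c, mFourierCoeff (fun x => (S a c x : ℂ)) k * (k c) * (k b) = 0 := by
  have hsf : ∀ c a, (fun x => (S c a x : ℂ)) = fun x => (S a c x : ℂ) :=
    fun c a => funext fun x => by rw [hsymm c a x]
  have hπ : ((4 * Real.pi ^ 2 : ℝ) : ℂ) ≠ 0 := by
    have : (0 : ℝ) < 4 * Real.pi ^ 2 := by positivity
    exact_mod_cast this.ne'
  -- the bracket of (2.10) equals the bracket produced by `mFourierCoeff_strainConsistency`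
  have hbr : ∀ (k : d → ℤ) a b,
      (Torus.freqNormSq k : ℂ) * mFourierCoeff (fun x => (S a b x : ℂ)) k -
          ∑ c, ((k a : ℂ) * (k c) * mFourierCoeff (fun x => (S c b x : ℂ)) k +
            (k b : ℂ) * (k c) * mFourierCoeff (fun x => (S c a x : ℂ)) k) =
        (Torus.freqNormSq k : ℂ) * mFourierCoeff (fun x => (S a b x : ℂ)) k -
          ∑ c, (k a : ℂ) * (k c) * mFourierCoeff (fun x => (S c b x : ℂ)) k -
          ∑ c, mFourierCoeff (fun x => (S a c x : ℂ)) k * (k c) * (k b) := by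
    intro k a b
    rw [Finset.sum_add_distrib, sub_add_eq_sub_sub]
    congr 1
    refine Finset.sum_congr rfl fun c _ => ?_
    rw [hsf c a]
    ring
  constructor
  · intro h k a b
    have h1 := Torus.mFourierCoeff_strainConsistency hS a b k
    rw [fc_of_eq_zero (h a b) k, hbr] at h1
    exact (mul_eq_zero.1 h1.symm).resolve_left hπ
  · intro h a b
    have hpair : ∀ c, Torus.IsSmooth fun x => Torus.partialDeriv a (Torus.partialDeriv c (S c b)) x +
        Torus.partialDeriv b (Torus.partialDeriv c (S c a)) x :=
      fun c => (((hS c b).partialDeriv c).partialDeriv a).add (((hS c a).partialDeriv c).partialDeriv b)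
    have hneg : Continuous fun x => -Torus.laplacian (S a b) x := (hS a b).laplacian.continuous.neg
    have hsum : Continuous fun x => ∑ c, (Torus.partialDeriv a (Torus.partialDeriv c (S c b)) x +
        Torus.partialDeriv b (Torus.partialDeriv c (S c a)) x) :=
      (isSmooth_sum Finset.univ fun c _ => hpair c).continuous
    have hG : Continuous fun x => -Torus.laplacian (S a b) x +
        ∑ c, (Torus.partialDeriv a (Torus.partialDeriv c (S c b)) x +
          Torus.partialDeriv b (Torus.partialDeriv c (S c a)) x) := hneg.add hsum
    refine eq_zero_of_fc hG fun k => ?_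
    rw [Torus.mFourierCoeff_strainConsistency hS a b k, hbr, h k a b, mul_zero]

/-! #### The forward direction: strains of divergence-free fields satisfy the consistency condition -/

variable {u : UnitAddTorus d → EuclideanSpace ℝ d}

/-- Fourier coefficients of the strain of a smooth field: `𝓕(S(u)_{ab})(k) = πi(k_b û_a + k_a û_b)`,
`S(u)_{ab} = ½((∂_b u)_a + (∂_a u)_b)`. [folklore] -/
private theorem fc_symGrad (hu : Torus.IsSmooth u) (a b : d) (k : d → ℤ) :
    mFourierCoeff (fun x => ((((Torus.partialDeriv b u x a + Torus.partialDeriv a u x b) / 2 : ℝ)) : ℂ)) k =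
      Real.pi * Complex.I * ((k b : ℂ) * mFourierCoeff (fun x => (u x a : ℂ)) k +
        (k a : ℂ) * mFourierCoeff (fun x => (u x b : ℂ)) k) := by
  have hu1 : Torus.IsContDiff 1 u := hu.isContDiff (by simp)
  have hfun : (fun x => ((((Torus.partialDeriv b u x a + Torus.partialDeriv a u x b) / 2 : ℝ)) : ℂ)) =
      fun x => ((((Torus.partialDeriv b (fun y => u y a) x +
        Torus.partialDeriv a (fun y => u y b) x) / 2 : ℝ)) : ℂ) := by
    funext x; rw [Torus.partialDeriv_apply_coord hu1, Torus.partialDeriv_apply_coord hu1]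
  rw [hfun, fc_div_two, fc_add ((hu.apply a).partialDeriv b).continuous ((hu.apply b).partialDeriv a).continuous,
    fc_partialDeriv (hu.apply a), fc_partialDeriv (hu.apply b)]
  ring

/-- Divergence-free fields have transversal Fourier coefficients: `∑_c k_c û_c(k) = 0`. [folklore] -/
private theorem fc_div (hu : Torus.IsSmooth u) (hdiv : Torus.IsDivFree u) (k : d → ℤ) :
    ∑ c, (k c : ℂ) * mFourierCoeff (fun x => (u x c : ℂ)) k = 0 := by
  have h0 : ∀ x, (∑ c, Torus.partialDeriv c (fun y => u y c) x) = 0 := fun x => hdiv x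
  have h1 := fc_of_eq_zero h0 k
  rw [fc_sum _ fun c _ => ((hu.apply c).partialDeriv c).continuous] at h1
  simp_rw [fc_partialDeriv (hu.apply _)] at h1
  have h2 : ∑ c, 2 * Real.pi * Complex.I * (k c : ℂ) * mFourierCoeff (fun x => (u x c : ℂ)) k =
      (2 * Real.pi * Complex.I) * ∑ c, (k c : ℂ) * mFourierCoeff (fun x => (u x c : ℂ)) k := by
    rw [Finset.mul_sum]
    exact Finset.sum_congr rfl fun c _ => by ring
  rw [h2] at h1
  have hne : (2 * Real.pi * Complex.I : ℂ) ≠ 0 := by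
    have hπ : (Real.pi : ℂ) ≠ 0 := by exact_mod_cast Real.pi_ne_zero
    simp [hπ, Complex.I_ne_zero]
  exact (mul_eq_zero.1 h1).resolve_left hne

/-- **Prop 2.3, forward direction** (Miller: "`−2 div(∇_{sym}u) = −Δu − ∇(∇·u) = −Δu`, applying
`∇_{sym}`, `−2∇_{sym}(div S) = −ΔS`"): the strain `S(u) = ∇_{sym}u` of a smooth divergence-free
field on `T^d` satisfies the consistency condition (2.11)
`−ΔS_{ab} + ∑_c (∂_a∂_c S_{cb} + ∂_b∂_c S_{ca}) = 0`. (Proof on Fourier coefficients: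
`Ŝ = πi(k⊗û + û⊗k)` with `k·û = 0` is annihilated by `|k|² − (k⊗k)· − ·(k⊗k)`.)
[cite: Miller2019, Prop 2.3 (proof, first half)] -/
theorem _root_.Literature.Analysis.FluidPDE.Torus.strainConsistency_symGrad
    (hu : Torus.IsSmooth u) (hdiv : Torus.IsDivFree u) (a b : d) (x : UnitAddTorus d) :
    -Torus.laplacian (fun y => (Torus.partialDeriv b u y a + Torus.partialDeriv a u y b) / 2) x +
        ∑ c, (Torus.partialDeriv a (Torus.partialDeriv c
            (fun y => (Torus.partialDeriv b u y c + Torus.partialDeriv c u y b) / 2)) x +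
          Torus.partialDeriv b (Torus.partialDeriv c
            (fun y => (Torus.partialDeriv a u y c + Torus.partialDeriv c u y a) / 2)) x) = 0 := by
  set S : d → d → UnitAddTorus d → ℝ := fun a b y =>
    (Torus.partialDeriv b u y a + Torus.partialDeriv a u y b) / 2 with hSdef
  have hDc : ∀ m j, Torus.IsSmooth (fun y => Torus.partialDeriv m u y j) := fun m j =>
    (hu.partialDeriv m).apply j
  have hS : ∀ a b, Torus.IsSmooth (S a b) := fun a b => ((hDc b a).add (hDc a b)).div_const 2
  have hsymm : ∀ a b x, S a b x = S b a x := fun a b x => by simp only [hSdef]; ring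
  have key := (Torus.strainConsistency_iff_fourier hS hsymm).2
  refine key (fun k a b => ?_) a b x
  simp only [hSdef]
  rw [fc_symGrad hu]
  simp_rw [fc_symGrad hu]
  have hD := fc_div hu hdiv k
  -- `|k|² = ∑_c k_c²`
  have hK : (Torus.freqNormSq k : ℂ) = ∑ c, (k c : ℂ) * (k c) := by
    rw [Torus.freqNormSq]; push_cast
    exact Finset.sum_congr rfl fun c _ => by ring
  rw [hK, Finset.sum_mul, ← Finset.sum_sub_distrib, ← Finset.sum_sub_distrib]
  have hterm : ∀ c, (k c : ℂ) * (k c) * (Real.pi * Complex.I *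
      ((k b : ℂ) * mFourierCoeff (fun x => (u x a : ℂ)) k + (k a : ℂ) * mFourierCoeff (fun x => (u x b : ℂ)) k)) -
      (k a : ℂ) * (k c) * (Real.pi * Complex.I *
        ((k b : ℂ) * mFourierCoeff (fun x => (u x c : ℂ)) k + (k c : ℂ) * mFourierCoeff (fun x => (u x b : ℂ)) k)) -
      Real.pi * Complex.I * ((k c : ℂ) * mFourierCoeff (fun x => (u x a : ℂ)) k +
        (k a : ℂ) * mFourierCoeff (fun x => (u x c : ℂ)) k) * (k c) * (k b) =
      (-(2 * Real.pi * Complex.I * (k a) * (k b))) * ((k c : ℂ) * mFourierCoeff (fun x => (u x c : ℂ)) k) := by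
    intro c; ring
  simp_rw [hterm]
  rw [← Finset.mul_sum, hD, mul_zero]

/-- **The strain of a divergence-free field is trace free**: `tr S(u) = ∇·u = 0` (Prop 2.3: "as we have
already shown, `tr(S) = ∇·u = 0`"). [cite: Miller2019, Prop 2.3 (proof)] -/
theorem _root_.Literature.Analysis.FluidPDE.Torus.sum_symGrad_diag_eq_zero
    (hu : Torus.IsSmooth u) (hdiv : Torus.IsDivFree u) (x : UnitAddTorus d) :
    ∑ a, (Torus.partialDeriv a u x a + Torus.partialDeriv a u x a) / 2 = 0 := by
  have hu1 : Torus.IsContDiff 1 u := hu.isContDiff (by simp)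
  have h := hdiv x
  rw [Torus.divergence_eq_sum_partialDeriv_apply hu1] at h
  rw [← h]
  exact Finset.sum_congr rfl fun a _ => by ring

/-- **The strain of a smooth field has mean zero** on `T^d` (its entries are derivatives of periodic
functions) — the zero-mode condition `Ŝ(0) = 0` that replaces, on the torus, the Lebesgue-null
frequency `ξ = 0` of Miller's `ℝ³` statement. [cite: Miller2019, Def 2.2 (`u ∈ Ḣ¹`); Evans2010, App. C.2 Thm. 1] -/
theorem _root_.Literature.Analysis.FluidPDE.Torus.integral_symGrad_eq_zero
    (hu : Torus.IsSmooth u) (a b : d) :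
    ∫ x, (Torus.partialDeriv b u x a + Torus.partialDeriv a u x b) / 2 = 0 := by
  have hu1 : Torus.IsContDiff 1 u := hu.isContDiff (by simp)
  have hfun : (fun x => (Torus.partialDeriv b u x a + Torus.partialDeriv a u x b) / 2) =
      fun x => (Torus.partialDeriv b (fun y => u y a) x + Torus.partialDeriv a (fun y => u y b) x) / 2 := by
    funext x; rw [Torus.partialDeriv_apply_coord hu1, Torus.partialDeriv_apply_coord hu1]
  rw [hfun, integral_div, integral_add ((hu.apply a).partialDeriv b).integrable
      ((hu.apply b).partialDeriv a).integrable,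
    Torus.integral_partialDeriv_eq_zero_holds (hu.apply a) b,
    Torus.integral_partialDeriv_eq_zero_holds (hu.apply b) a]
  simp

/-! #### The converse direction: consistency forces `P_{st}S = S`, hence `S = ∇_{sym}u`, `∇·u = 0` -/

/-- **Prop 2.3, converse direction, via the projection**: a smooth symmetric, trace-free, mean-zero
matrix field `S` on `T^d` satisfying the consistency condition (2.11) is fixed by `P_{st}`:
`P_{st}S = S`. (Miller's proof: `u := (−Δ)⁻¹(−2 div S)` has `∇_{sym}u = (−Δ)⁻¹(−2∇_{sym}div S)
= (−Δ)⁻¹(−ΔS) = S`; here read on Fourier coefficients — the consistency condition gives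
`|k|²Ŝ_{ab} = k_a(Ŝk)_b + k_b(Ŝk)_a` and, on the diagonal with `tr Ŝ = 0`, `kᵀŜk = 0`, so the
symbol of `P_{st}` returns `Ŝ`; the zero mode is the mean-zero hypothesis.)
[cite: Miller2019, Prop 2.3 (proof, second half) and display (2.7)] -/
theorem _root_.Literature.Analysis.FluidPDE.Torus.strainProjection_eq_self_of_strainConsistency [Nonempty d]
    (hS : ∀ a b, Torus.IsSmooth (S a b)) (hsymm : ∀ a b x, S a b x = S b a x)
    (htr : ∀ x, ∑ a, S a a x = 0) (h0 : ∀ a b, ∫ x, S a b x = 0)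
    (hC : ∀ a b x, -Torus.laplacian (S a b) x +
        ∑ c, (Torus.partialDeriv a (Torus.partialDeriv c (S c b)) x +
          Torus.partialDeriv b (Torus.partialDeriv c (S c a)) x) = 0)
    (a b : d) (x : UnitAddTorus d) :
    Torus.strainProjection S a b x = S a b x := by
  have hF := (Torus.strainConsistency_iff_fourier hS hsymm).1 hC
  have hsf : ∀ c e, (fun x => (S c e x : ℂ)) = fun x => (S e c x : ℂ) :=
    fun c e => funext fun x => by rw [hsymm c e x]
  -- compare Fourier coefficients of the two continuous functions
  suffices hfun : (fun x => (((Torus.strainProjection S a b x : ℝ)) : ℂ)) = fun x => (S a b x : ℂ) by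
    exact_mod_cast congr_fun hfun x
  refine Torus.eq_of_forall_mFourierCoeff_eq
    (Complex.continuous_ofReal.comp (Torus.isSmooth_strainProjection hS a b).continuous)
    (Complex.continuous_ofReal.comp (hS a b).continuous) fun k => ?_
  -- the symbol with `N = Ŝ(k)`
  rw [Torus.mFourierCoeff_strainProjection_of_symm hS hsymm k
    (fun e c => mFourierCoeff (fun x => (S e c x : ℂ)) k) (fun e c => rfl) a b]
  by_cases hk : k = 0
  · subst hk
    rw [fc_zero, h0 a b]
    simp
  · have hK : (Torus.freqNormSq k : ℂ) ≠ 0 := by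
      have := Torus.one_le_freqNormSq_of_ne_zero hk
      exact_mod_cast (by linarith : Torus.freqNormSq k ≠ 0)
    -- notation-free abbreviations
    set F : d → d → ℂ := fun e c => mFourierCoeff (fun x => (S e c x : ℂ)) k with hFdef
    have hFsymm : ∀ e c, F c e = F e c := fun e c => by simp only [hFdef]; rw [hsf c e]
    -- (2.10) in the form `K F_ab = k_a T_b + k_b T_a`, `T_b = ∑_c F_bc k_c`
    have hrow : ∀ a b, (Torus.freqNormSq k : ℂ) * F a b =
        (k a : ℂ) * ∑ c, F b c * (k c) + (k b : ℂ) * ∑ c, F a c * (k c) := by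
      intro a b
      have h := hF k a b
      rw [sub_sub, sub_eq_zero] at h
      simp only [hFdef]
      rw [h, Finset.mul_sum, Finset.mul_sum]
      congr 1
      · exact Finset.sum_congr rfl fun c _ => by rw [hsf c b]; ring
      · exact Finset.sum_congr rfl fun c _ => by ring
    -- trace: `∑_e F_ee = 0`
    have htrF : ∑ e, F e e = 0 := by
      have h := fc_of_eq_zero htr k
      rwa [fc_sum _ fun e _ => (hS e e).continuous] at h
    -- hence `Q = kᵀFk = (K/2) tr F = 0`
    have hQ : ∑ e, ∑ c, (k e : ℂ) * F e c * (k c) = 0 := by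
      have h1 : ∑ e, ∑ c, (k e : ℂ) * F e c * (k c) = ∑ e, (Torus.freqNormSq k : ℂ) * F e e / 2 := by
        refine Finset.sum_congr rfl fun e _ => ?_
        rw [hrow e e]
        have : ∑ c, (k e : ℂ) * F e c * (k c) = (k e : ℂ) * ∑ c, F e c * (k c) := by
          rw [Finset.mul_sum]; exact Finset.sum_congr rfl fun c _ => by ring
        rw [this]
        ring
      rw [h1, ← Finset.sum_div, ← Finset.mul_sum, htrF, mul_zero, zero_div]
    rw [hQ, zero_div, zero_mul, sub_zero, zero_mul, sub_zero, ← hrow a b,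
      mul_div_cancel_left₀ _ hK]

/-- **Miller's reconstruction formula on the torus**: under the hypotheses of the converse direction
the gradient correction in the potential vanishes (`div div S = ½Δ tr S = 0`), so
`z_S = 2Δ⁻¹ div S = −2 div(−Δ)⁻¹S` — verbatim the field `u` of ARMA (2.7)/(2.15)
"`u = (−Δ)⁻¹(−2 div S)`" (tree `Δ⁻¹ = Torus.invLaplacian = −(−Δ)⁻¹`). [cite: Miller2019, §2 display (2.7) and Prop 2.3 (proof, display (2.15))] -/
theorem _root_.Literature.Analysis.FluidPDE.Torus.strainPotential_eq_of_strainConsistency [Nonempty d]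
    (hS : ∀ a b, Torus.IsSmooth (S a b)) (hsymm : ∀ a b x, S a b x = S b a x)
    (htr : ∀ x, ∑ a, S a a x = 0)
    (hC : ∀ a b x, -Torus.laplacian (S a b) x +
        ∑ c, (Torus.partialDeriv a (Torus.partialDeriv c (S c b)) x +
          Torus.partialDeriv b (Torus.partialDeriv c (S c a)) x) = 0)
    (x : UnitAddTorus d) (b : d) :
    Torus.strainPotential S x b = 2 * Torus.invLaplacian (Torus.strainDiv S b) x := by
  have hF := (Torus.strainConsistency_iff_fourier hS hsymm).1 hC
  have hsf : ∀ c e, (fun x => (S c e x : ℂ)) = fun x => (S e c x : ℂ) :=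
    fun c e => funext fun x => by rw [hsymm c e x]
  -- `div div S = 0`: all Fourier coefficients vanish
  have hDD0 : ∀ y, Torus.strainDivDiv S y = 0 := by
    refine eq_zero_of_fc (Torus.isSmooth_strainDivDiv hS).continuous fun k => ?_
    rw [fc_strainDivDiv_N hS k (fun e c => mFourierCoeff (fun x => (S e c x : ℂ)) k)
      (fun e c => by rw [hsf c e]; ring)]
    by_cases hk : k = 0
    · subst hk; simp
    · set F : d → d → ℂ := fun e c => mFourierCoeff (fun x => (S e c x : ℂ)) k with hFdef
      have hFsymm : ∀ e c, F c e = F e c := fun e c => by simp only [hFdef]; rw [hsf c e]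
      have hrow : ∀ e, (Torus.freqNormSq k : ℂ) * F e e = 2 * ((k e : ℂ) * ∑ c, F e c * (k c)) := by
        intro e
        have h := hF k e e
        rw [sub_sub, sub_eq_zero] at h
        simp only [hFdef]
        rw [h, two_mul, Finset.mul_sum]
        congr 1
        · exact Finset.sum_congr rfl fun c _ => by rw [hsf c e]; ring
        · exact Finset.sum_congr rfl fun c _ => by ring
      have htrF : ∑ e, F e e = 0 := by
        have h := fc_of_eq_zero htr k
        rwa [fc_sum _ fun e _ => (hS e e).continuous] at h
      have hQ : ∑ e, ∑ c, (k e : ℂ) * F e c * (k c) = 0 := by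
        have h1 : ∑ e, ∑ c, (k e : ℂ) * F e c * (k c) = ∑ e, (Torus.freqNormSq k : ℂ) * F e e / 2 := by
          refine Finset.sum_congr rfl fun e _ => ?_
          rw [hrow e]
          have : ∑ c, (k e : ℂ) * F e c * (k c) = (k e : ℂ) * ∑ c, F e c * (k c) := by
            rw [Finset.mul_sum]; exact Finset.sum_congr rfl fun c _ => by ring
          rw [this]
          ring
        rw [h1, ← Finset.sum_div, ← Finset.mul_sum, htrF, mul_zero, zero_div]
      rw [hQ, mul_zero]
  have hDDfun : Torus.strainDivDiv S = fun _ => (0 : ℝ) := funext hDD0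
  have hI0 : Torus.invLaplacian (Torus.invLaplacian (Torus.strainDivDiv S)) = fun _ => (0 : ℝ) := by
    rw [hDDfun]
    have hz : (fun _ : UnitAddTorus d => (0 : ℝ)) = (0 : UnitAddTorus d → ℝ) := rfl
    rw [hz, Torus.invLaplacian_zero, Torus.invLaplacian_zero]
  rw [Torus.strainPotential_apply, hI0]
  have hd0 : Torus.partialDeriv b (fun _ : UnitAddTorus d => (0 : ℝ)) x = 0 := by
    simp [Torus.partialDeriv, Torus.lineDeriv]
  rw [hd0, mul_zero, sub_zero]

/-- **Miller, ARMA 235 (2020), Prop 2.3 (characterisation of the strain subspace), on `T^d`.**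
For a smooth symmetric matrix field `S` on the flat torus (`d` nonempty) the following are equivalent:
(i) `S ∈ L²_{st}`, i.e. `S = ∇_{sym}u = ½(∇⊗u + (∇⊗u)ᵀ)` for a smooth divergence-free `u` (Def 2.2);
(ii) `tr S = 0`, `∫ S = 0`, and the consistency condition `−ΔS + 2∇_{sym}(div S) = 0`, in
components (2.11) `−ΔS_{ab} + ∑_c (∂_a∂_c S_{cb} + ∂_b∂_c S_{ca}) = 0`.
Printed statement: "Suppose `S ∈ L²(ℝ³; S^{3×3})`. Then `S ∈ L²_{st}` if and only if
`−ΔS + 2∇_{sym}(div S) = 0`, `tr(S) = 0`." TORUS DEVIATION: the zero-mode condition `∫ S = 0`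
(`Ŝ(0) = 0`) must be added on `T^d` — on `ℝ³` the frequency `ξ = 0` is Lebesgue-null and
`u ∈ Ḣ¹` is homogeneous; constant trace-free symmetric matrices satisfy (2.11) but are not periodic
strains. The witness in (ii) ⇒ (i) is Miller's `u = −2 div(−Δ)⁻¹S`
(`Torus.strainPotential_eq_of_strainConsistency`). [cite: Miller2019, Def 2.2 and Prop 2.3] -/
theorem _root_.Literature.Analysis.FluidPDE.Torus.exists_symGrad_iff_strainConsistency [Nonempty d]
    (hS : ∀ a b, Torus.IsSmooth (S a b)) (hsymm : ∀ a b x, S a b x = S b a x) :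
    (∃ u : UnitAddTorus d → EuclideanSpace ℝ d, Torus.IsSmooth u ∧ Torus.IsDivFree u ∧
        ∀ a b x, S a b x = (Torus.partialDeriv b u x a + Torus.partialDeriv a u x b) / 2) ↔
      ((∀ x, ∑ a, S a a x = 0) ∧ (∀ a b, ∫ x, S a b x = 0) ∧
        ∀ a b x, -Torus.laplacian (S a b) x +
          ∑ c, (Torus.partialDeriv a (Torus.partialDeriv c (S c b)) x +
            Torus.partialDeriv b (Torus.partialDeriv c (S c a)) x) = 0) := by
  constructor
  · rintro ⟨u, hu, hdiv, hSu⟩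
    have hfun : S = fun a b x => (Torus.partialDeriv b u x a + Torus.partialDeriv a u x b) / 2 :=
      funext fun a => funext fun b => funext fun x => hSu a b x
    subst hfun
    exact ⟨Torus.sum_symGrad_diag_eq_zero hu hdiv, Torus.integral_symGrad_eq_zero hu,
      Torus.strainConsistency_symGrad hu hdiv⟩
  · rintro ⟨htr, h0, hC⟩
    refine ⟨Torus.strainPotential S, Torus.isSmooth_strainPotential hS,
      Torus.isDivFree_strainPotential hS, fun a b x => ?_⟩
    rw [← Torus.strainProjection_eq_self_of_strainConsistency hS hsymm htr h0 hC a b x,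
      Torus.strainProjection, add_comm]

/-- **`L²_{st}` = the fixed points of `P_{st}`** (smooth fields on `T^d`): for a smooth symmetric
matrix field `S`, `P_{st}S = S` iff `tr S = 0`, `∫ S = 0` and the consistency condition (2.11) holds
(iff `S = ∇_{sym}u` for a smooth divergence-free `u`, `Torus.exists_symGrad_iff_strainConsistency`).
[cite: Miller2019, Def 2.2 and Prop 2.3; Miller2023StrainModel, Def 1.2 (`P_{st}` the projection onto `L²_{st}`)] -/
theorem _root_.Literature.Analysis.FluidPDE.Torus.strainProjection_eq_self_iff_strainConsistency
    [Nonempty d] (hS : ∀ a b, Torus.IsSmooth (S a b)) (hsymm : ∀ a b x, S a b x = S b a x) :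
    (∀ a b x, Torus.strainProjection S a b x = S a b x) ↔
      ((∀ x, ∑ a, S a a x = 0) ∧ (∀ a b, ∫ x, S a b x = 0) ∧
        ∀ a b x, -Torus.laplacian (S a b) x +
          ∑ c, (Torus.partialDeriv a (Torus.partialDeriv c (S c b)) x +
            Torus.partialDeriv b (Torus.partialDeriv c (S c a)) x) = 0) := by
  rw [← Torus.exists_symGrad_iff_strainConsistency hS hsymm]
  constructor
  · intro h
    refine ⟨Torus.strainPotential S, Torus.isSmooth_strainPotential hS,
      Torus.isDivFree_strainPotential hS, fun a b x => ?_⟩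
    rw [← h a b x, Torus.strainProjection, add_comm]
  · rintro ⟨u, hu, hdiv, hSu⟩ a b x
    have hfun : S = fun a b x => (Torus.partialDeriv b u x a + Torus.partialDeriv a u x b) / 2 :=
      funext fun a => funext fun b => funext fun x => hSu a b x
    subst hfun
    exact Torus.strainProjection_symGrad hu hdiv a b x

end Consistency

/-! ### §3 A single diagonal entry of a strain carries at most half of the `L²` mass
(Miller–Sawyer, Trans. AMS Ser. B 10 (2023), Thm 3.1) -/

section DiagonalEntry

variable {u : UnitAddTorus d → EuclideanSpace ℝ d}

omit [DecidableEq d] in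
/-- `∑_{ab}(κ_b p_a + κ_a p_b)² = 2|κ|²|p|² + 2(κ·p)²` for real vectors. [folklore] -/
private theorem sum_sum_sq_symm_outer (κ p : d → ℝ) :
    ∑ a, ∑ b, (κ b * p a + κ a * p b) ^ 2 =
      2 * (∑ a, κ a ^ 2) * (∑ a, p a ^ 2) + 2 * (∑ a, κ a * p a) ^ 2 := by
  have e : ∀ a b, (κ b * p a + κ a * p b) ^ 2 =
      p a ^ 2 * κ b ^ 2 + κ a ^ 2 * p b ^ 2 + (2 * (κ a * p a)) * (κ b * p b) := fun a b => by ring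
  simp_rw [e, Finset.sum_add_distrib]
  rw [← Finset.sum_mul_sum, ← Finset.sum_mul_sum, ← Finset.sum_mul_sum, ← Finset.mul_sum]
  ring

omit [DecidableEq d] in
/-- Real core of Thm 3.1, one Fourier mode: for real `v, κ, p` with `|v| = 1`, `|κ|² = K > 0` and
`κ·p = 0`, `4(v·κ)²(v·p)² ≤ K|p|²` (`v·p = (v − ((v·κ)/K)κ)·p`, Cauchy–Schwarz with
`|v − ((v·κ)/K)κ|² = 1 − (v·κ)²/K`, and `4s(1 − s) ≤ 1`). [cite: MillerSawyer2023, Thm 3.1 (proof)] -/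
private theorem mode_diag_bound (v κ p : d → ℝ) (hv : ∑ a, v a ^ 2 = 1) {K : ℝ}
    (hKdef : ∑ a, κ a ^ 2 = K) (hK : 0 < K) (hkp : ∑ a, κ a * p a = 0) :
    4 * (∑ a, v a * κ a) ^ 2 * (∑ a, v a * p a) ^ 2 ≤ K * ∑ a, p a ^ 2 := by
  obtain ⟨t, ht⟩ : ∃ t : ℝ, ∑ a, v a * κ a = t := ⟨_, rfl⟩
  obtain ⟨P, hP⟩ : ∃ P : ℝ, ∑ a, p a ^ 2 = P := ⟨_, rfl⟩
  rw [ht, hP]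
  have hw : ∑ a, (v a - t / K * κ a) * p a = ∑ a, v a * p a := by
    have e : ∀ a, (v a - t / K * κ a) * p a = v a * p a - t / K * (κ a * p a) := fun a => by ring
    simp_rw [e]
    rw [Finset.sum_sub_distrib, ← Finset.mul_sum, hkp, mul_zero, sub_zero]
  have hw2 : ∑ a, (v a - t / K * κ a) ^ 2 = 1 - t ^ 2 / K := by
    have e : ∀ a, (v a - t / K * κ a) ^ 2 =
        v a ^ 2 - 2 * (t / K) * (v a * κ a) + (t / K) ^ 2 * κ a ^ 2 := fun a => by ring
    simp_rw [e]
    rw [Finset.sum_add_distrib, Finset.sum_sub_distrib, ← Finset.mul_sum, ← Finset.mul_sum, hv, ht,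
      hKdef]
    field_simp
    ring
  have hCS : (∑ a, (v a - t / K * κ a) * p a) ^ 2 ≤
      (∑ a, (v a - t / K * κ a) ^ 2) * ∑ a, p a ^ 2 :=
    Finset.sum_mul_sq_le_sq_mul_sq _ _ _
  rw [hw, hw2, hP] at hCS
  have hP0 : 0 ≤ P := by rw [← hP]; exact Finset.sum_nonneg fun a _ => sq_nonneg _
  have h4 : 4 * t ^ 2 * (1 - t ^ 2 / K) ≤ K := by
    have e : 4 * t ^ 2 * (1 - t ^ 2 / K) = K - (K - 2 * t ^ 2) ^ 2 / K := by
      field_simp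
      ring
    rw [e]
    have : 0 ≤ (K - 2 * t ^ 2) ^ 2 / K := div_nonneg (sq_nonneg _) hK.le
    linarith
  calc 4 * t ^ 2 * (∑ a, v a * p a) ^ 2 ≤ 4 * t ^ 2 * ((1 - t ^ 2 / K) * P) :=
        mul_le_mul_of_nonneg_left hCS (by positivity)
    _ = (4 * t ^ 2 * (1 - t ^ 2 / K)) * P := by ring
    _ ≤ K * P := mul_le_mul_of_nonneg_right h4 hP0

/-- **Miller–Sawyer, Thm 3.1 on `T^d` — a single diagonal entry of a strain carries at most half of
its `L²` mass**: for a smooth divergence-free field `u` on `T^d` with strain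
`S_{ab} = ½((∂_b u)_a + (∂_a u)_b)` and every unit vector `v ∈ ℝ^d` (`∑ v_a² = 1`),
`‖vᵀSv‖²_{L²} ≤ ½‖S‖²_{L²}`, i.e. `∫ (∑_{ab} v_a v_b S_{ab})² ≤ ½ ∫ ∑_{ab} S_{ab}²` (printed for
`S ∈ L²_{st}(ℝ³)`: "`‖S_{33}‖²_{L²} ≤ ½‖S‖²_{L²}`; more generally `‖S ⊙ (v⊗v)‖²_{L²} ≤ ½‖S‖²_{L²}`").
PROOF = the printed Fourier computation, mode by mode on `ℤ^d`: `Ŝ(k) = πi(k⊗û + û⊗k)` with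
`k·û = 0` (`fc_symGrad`, `fc_div`), so `vᵀŜ(k)v = 2πi(v·k)(v·û)` and `|Ŝ(k)|² = 2π²|k|²|û|²`, and
`4(v·k)²|v·û|² ≤ |k|²|û|²` because `v·û = (v − ((v·k)/|k|²)k)·û` (Cauchy–Schwarz, `4s(1−s) ≤ 1`,
`s = (v·k)²/|k|²`; `SymmetricHelmholtz`-style real core `mode_diag_bound`, applied to the real and
imaginary parts of `û`); then Parseval on both sides. Sharpness (Thm 3.2: near-maximisers with
`supp Ŝ` near the cone `ξ_v² = |ξ|²/2`) is not typed. [cite: MillerSawyer2023, Thm 3.1] -/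
theorem _root_.Literature.Analysis.FluidPDE.Torus.integral_sq_symGrad_diag_le_half
    (hu : Torus.IsSmooth u) (hdiv : Torus.IsDivFree u) (v : d → ℝ) (hv : ∑ a, v a ^ 2 = 1) :
    ∫ x, (∑ a, ∑ b, v a * v b * ((Torus.partialDeriv b u x a + Torus.partialDeriv a u x b) / 2)) ^ 2 ≤
      2⁻¹ * ∫ x, ∑ a, ∑ b, ((Torus.partialDeriv b u x a + Torus.partialDeriv a u x b) / 2) ^ 2 := by
  have hDc : ∀ m j, Torus.IsSmooth (fun y => Torus.partialDeriv m u y j) := fun m j =>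
    (hu.partialDeriv m).apply j
  have hSs : ∀ a b, Torus.IsSmooth (fun x => (Torus.partialDeriv b u x a + Torus.partialDeriv a u x b) / 2) :=
    fun a b => ((hDc b a).add (hDc a b)).div_const 2
  have hSc : ∀ a b, Continuous (fun x => (Torus.partialDeriv b u x a + Torus.partialDeriv a u x b) / 2) :=
    fun a b => (hSs a b).continuous
  have hVS : ∀ a b, Torus.IsSmooth (fun x => v a * v b *
      ((Torus.partialDeriv b u x a + Torus.partialDeriv a u x b) / 2)) :=
    fun a b => smooth_const_mul _ (hSs a b)
  have hrow : ∀ a, Torus.IsSmooth (fun x => ∑ b, v a * v b *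
      ((Torus.partialDeriv b u x a + Torus.partialDeriv a u x b) / 2)) :=
    fun a => isSmooth_sum _ fun b _ => hVS a b
  have hF : Torus.IsSmooth (fun x => ∑ a, ∑ b, v a * v b *
      ((Torus.partialDeriv b u x a + Torus.partialDeriv a u x b) / 2)) :=
    isSmooth_sum _ fun a _ => hrow a
  -- Parseval on both sides
  have hL := Torus.hasSum_sq_mFourierCoeff_ofReal hF.continuous
  have hR := (hasSum_sum (fun a (_ : a ∈ Finset.univ) => hasSum_sum_sq Finset.univ
    (fun b (_ : b ∈ Finset.univ) => hSc a b))).mul_left (2⁻¹ : ℝ)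
  have hS2 : ∀ a b, Torus.IsSmooth (fun x =>
      ((Torus.partialDeriv b u x a + Torus.partialDeriv a u x b) / 2) ^ 2) := fun a b => (hSs a b).pow 2
  have hswap : ∫ x, ∑ a, ∑ b, ((Torus.partialDeriv b u x a + Torus.partialDeriv a u x b) / 2) ^ 2 =
      ∑ a, ∑ b, ∫ x, ((Torus.partialDeriv b u x a + Torus.partialDeriv a u x b) / 2) ^ 2 := by
    rw [integral_finsetSum _ fun a _ => (isSmooth_sum _ fun b _ => hS2 a b).integrable]
    exact Finset.sum_congr rfl fun a _ => integral_finsetSum _ fun b _ => (hS2 a b).integrable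
  rw [hswap]
  refine hasSum_le (fun k => ?_) hL hR
  -- one Fourier mode
  obtain ⟨z, hz⟩ : ∃ z : d → ℂ, ∀ c, mFourierCoeff (fun x => (u x c : ℂ)) k = z c := ⟨_, fun _ => rfl⟩
  obtain ⟨p, hp⟩ : ∃ p : d → ℝ, ∀ c, (z c).re = p c := ⟨_, fun _ => rfl⟩
  obtain ⟨q, hq⟩ : ∃ q : d → ℝ, ∀ c, (z c).im = q c := ⟨_, fun _ => rfl⟩
  obtain ⟨t, ht⟩ : ∃ t : ℝ, ∑ a, v a * (k a : ℝ) = t := ⟨_, rfl⟩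
  -- transversality `k·û = 0`, real and imaginary parts
  have hdivz : ∑ c, (k c : ℂ) * z c = 0 := by
    have h := fc_div hu hdiv k
    simp_rw [hz] at h
    exact h
  have hkp : ∑ c, (k c : ℝ) * p c = 0 := by
    have h := congrArg Complex.re hdivz
    rw [Complex.re_sum] at h
    simpa [Complex.mul_re, hp, hq] using h
  have hkq : ∑ c, (k c : ℝ) * q c = 0 := by
    have h := congrArg Complex.im hdivz
    rw [Complex.im_sum] at h
    simpa [Complex.mul_im, hp, hq] using h
  -- the coefficient of `vᵀSv`
  have hcoefF : mFourierCoeff (fun x => (((∑ a, ∑ b, v a * v b *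
      ((Torus.partialDeriv b u x a + Torus.partialDeriv a u x b) / 2) : ℝ)) : ℂ)) k =
      ((2 * Real.pi * t : ℝ) : ℂ) * (Complex.I * ∑ b, (v b : ℂ) * z b) := by
    rw [fc_sum _ fun a _ => (hrow a).continuous]
    have h1 : ∀ a, mFourierCoeff (fun x => (((∑ b, v a * v b *
        ((Torus.partialDeriv b u x a + Torus.partialDeriv a u x b) / 2) : ℝ)) : ℂ)) k =
        ∑ b, ((v a * v b : ℝ) : ℂ) * (Real.pi * Complex.I * ((k b : ℂ) * z a + (k a : ℂ) * z b)) := by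
      intro a
      rw [fc_sum _ fun b _ => (hVS a b).continuous]
      refine Finset.sum_congr rfl fun b _ => ?_
      rw [fc_const_mul, fc_symGrad hu a b k, hz, hz]
    simp_rw [h1]
    have e : ∀ a b, ((v a * v b : ℝ) : ℂ) * (Real.pi * Complex.I * ((k b : ℂ) * z a + (k a : ℂ) * z b)) =
        Real.pi * Complex.I * (((v a : ℂ) * z a) * ((v b : ℂ) * (k b : ℂ))) +
          Real.pi * Complex.I * (((v a : ℂ) * (k a : ℂ)) * ((v b : ℂ) * z b)) := by
      intro a b; push_cast; ring
    simp_rw [e, Finset.sum_add_distrib]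
    have s1 : ∑ a, ∑ b, (Real.pi : ℂ) * Complex.I * (((v a : ℂ) * z a) * ((v b : ℂ) * (k b : ℂ))) =
        (Real.pi : ℂ) * Complex.I * ((∑ a, (v a : ℂ) * z a) * ∑ b, (v b : ℂ) * (k b : ℂ)) := by
      rw [Finset.sum_mul_sum, Finset.mul_sum]
      refine Finset.sum_congr rfl fun a _ => ?_
      rw [Finset.mul_sum]
    have s2 : ∑ a, ∑ b, (Real.pi : ℂ) * Complex.I * (((v a : ℂ) * (k a : ℂ)) * ((v b : ℂ) * z b)) =
        (Real.pi : ℂ) * Complex.I * ((∑ a, (v a : ℂ) * (k a : ℂ)) * ∑ b, (v b : ℂ) * z b) := by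
      rw [Finset.sum_mul_sum, Finset.mul_sum]
      refine Finset.sum_congr rfl fun a _ => ?_
      rw [Finset.mul_sum]
    have hT : ∑ a, (v a : ℂ) * (k a : ℂ) = (t : ℂ) := by
      rw [← ht]; push_cast; rfl
    rw [s1, s2, hT]
    push_cast
    ring
  -- the coefficients of the entries
  have hcoefS : ∀ a b, ‖mFourierCoeff (fun x =>
      ((((Torus.partialDeriv b u x a + Torus.partialDeriv a u x b) / 2 : ℝ)) : ℂ)) k‖ ^ 2 =
      Real.pi ^ 2 * (((k b : ℝ) * p a + (k a : ℝ) * p b) ^ 2 + ((k b : ℝ) * q a + (k a : ℝ) * q b) ^ 2) := by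
    intro a b
    rw [fc_symGrad hu a b k, hz, hz, norm_mul, norm_mul, Complex.norm_real, Complex.norm_I,
      Real.norm_eq_abs, mul_one, mul_pow, sq_abs, Complex.sq_norm, Complex.normSq_apply]
    have hre : ((k b : ℂ) * z a + (k a : ℂ) * z b).re = (k b : ℝ) * p a + (k a : ℝ) * p b := by
      simp [Complex.add_re, Complex.mul_re, hp, hq]
    have him : ((k b : ℂ) * z a + (k a : ℂ) * z b).im = (k b : ℝ) * q a + (k a : ℝ) * q b := by
      simp [Complex.add_im, Complex.mul_im, hp, hq]
    rw [hre, him]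
    ring
  have hU : ‖Complex.I * ∑ b, (v b : ℂ) * z b‖ ^ 2 = (∑ b, v b * p b) ^ 2 + (∑ b, v b * q b) ^ 2 := by
    rw [norm_mul, Complex.norm_I, one_mul, Complex.sq_norm, Complex.normSq_apply, Complex.re_sum,
      Complex.im_sum]
    simp only [Complex.re_ofReal_mul, Complex.im_ofReal_mul, hp, hq]
    ring
  rw [hcoefF, norm_mul, mul_pow, Complex.norm_real, Real.norm_eq_abs, sq_abs, hU]
  simp_rw [hcoefS]
  have hsplit : ∑ a, ∑ b, Real.pi ^ 2 * (((k b : ℝ) * p a + (k a : ℝ) * p b) ^ 2 +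
      ((k b : ℝ) * q a + (k a : ℝ) * q b) ^ 2) =
      Real.pi ^ 2 * ((∑ a, ∑ b, ((k b : ℝ) * p a + (k a : ℝ) * p b) ^ 2) +
        ∑ a, ∑ b, ((k b : ℝ) * q a + (k a : ℝ) * q b) ^ 2) := by
    rw [← Finset.sum_add_distrib, Finset.mul_sum]
    refine Finset.sum_congr rfl fun a _ => ?_
    rw [← Finset.sum_add_distrib, Finset.mul_sum]
  rw [hsplit, sum_sum_sq_symm_outer (fun c => (k c : ℝ)) p, sum_sum_sq_symm_outer (fun c => (k c : ℝ)) q, hkp, hkq]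
  obtain ⟨K, hKdef⟩ : ∃ K : ℝ, ∑ a, ((k a : ℝ)) ^ 2 = K := ⟨_, rfl⟩
  rw [hKdef]
  have hπ : 0 ≤ Real.pi ^ 2 := sq_nonneg _
  by_cases hk : k = 0
  · subst hk
    have ht0 : t = 0 := by rw [← ht]; simp
    rw [ht0]
    have hP0 : 0 ≤ ∑ a, p a ^ 2 := Finset.sum_nonneg fun a _ => sq_nonneg _
    have hQ0 : 0 ≤ ∑ a, q a ^ 2 := Finset.sum_nonneg fun a _ => sq_nonneg _
    have hK0 : 0 ≤ K := by rw [← hKdef]; exact Finset.sum_nonneg fun a _ => sq_nonneg _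
    nlinarith [mul_nonneg hK0 hP0, mul_nonneg hK0 hQ0]
  · have hK : 0 < K := by
      rw [← hKdef]
      exact lt_of_lt_of_le zero_lt_one (Torus.one_le_freqNormSq_of_ne_zero hk)
    have vp := mode_diag_bound v (fun c => (k c : ℝ)) p hv hKdef hK hkp
    have vq := mode_diag_bound v (fun c => (k c : ℝ)) q hv hKdef hK hkq
    rw [ht] at vp vq
    nlinarith [vp, vq, hπ, mul_nonneg hπ (sub_nonneg.2 vp), mul_nonneg hπ (sub_nonneg.2 vq)]

end DiagonalEntry

end StrainSubspaceFourier

end Literature.Analysis.FluidPDE
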